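import Literature.Probability.Percolation.AdjSlotDefs
import HarnessLib

/-!
# Arithmetic of the outer rung of the adjacent separation scheme

Topic `Literature/Probability/Percolation`; family `crit-perc` / near-critical percolation on `𝕋`.
Bookkeeping for the outer multi-scale scheme of the near-critical arm-separation theorem for four
arms in the ADJACENT colour arrangement (P. Nolin, EJP 13 (2008), Thm. 11, `j = 4`, `σ = BBWW`
[arXiv 0711.4948: Thm. 10], §4.4 pp. 11–13): the outer rung of half-radius `M` with
`k₀ = 4 ⌊M / (4D)⌋` (a multiple of four, as the adjacent landing requires, `OParams.ValidA`),
`K` scales and tip margin `R₀ = 8 μ` is valid for `M ≥ 64 D`, `D ≥ 256 · 32^K`, and its slot count,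
ring size and spoke aspect ratio are bounded in terms of `D, K` only.

* `arung M n D K`, `arung_validA`;
* `arung_nA_le`, `arung_GrA7_le` (`GrA 7 ≤ 156 D + 44`), `arung_NwA_le` (`NwA ≤ 13 D + 5`),
  `arung_aspect7` (`LL 7 ≤ 256 · 32^K · 2ε`), `arung_aslotBound_le`, `arung_slots_le`.

Everything here is proved; no named facts are introduced.

## References

* P. Nolin, Near-critical percolation in two dimensions, *Electron. J. Probab.* 13 (2008), §4.4
  Thm. 11 (arXiv 0711.4948: Thm. 10, pp. 11–13) [Nolin2008].
-/

noncomputable section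

namespace Literature.Probability.Percolation

open LatticeModels

/-- **The outer rung of the adjacent scheme** of half-radius `M`: `k₀ = 4 ⌊M/(4D)⌋`, `K` scales,
`R₀ = 8 μ`. [folklore] -/
def arung (M n D K : ℕ) : OParams := ⟨M, n, 4 * (M / (4 * D)), K, 8 * trapScale (4 * (M / (4 * D))) K⟩

/-- Basic sizes of the rung: `64 ≤ k₀ ≤ M / D`, `4 ∣ k₀`, `256 μ ≤ M` (`D ≥ 256 · 32^K`, `M ≥ 64 D`). [folklore] -/
theorem arung_sizes {M D K : ℕ} (hD : 256 * 32 ^ K ≤ D) (hM : 64 * D ≤ M) :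
    64 ≤ 4 * (M / (4 * D)) ∧ 4 * (M / (4 * D)) ≤ M / D ∧ D * (4 * (M / (4 * D))) ≤ M ∧ 256 * trapScale (4 * (M / (4 * D))) K ≤ M := by
  have hX : 1 ≤ 32 ^ K := Nat.one_le_pow _ _ (by norm_num)
  have hD1 : 1 ≤ D := by omega
  have hq : 16 ≤ M / (4 * D) := (Nat.le_div_iff_mul_le (by omega)).2 (by linarith)
  have hqD : 4 * D * (M / (4 * D)) ≤ M := Nat.mul_div_le M (4 * D)
  have h2 : 4 * (M / (4 * D)) ≤ M / D := (Nat.le_div_iff_mul_le (by omega)).2 (by linarith)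
  refine ⟨by omega, h2, by linarith, ?_⟩
  unfold trapScale
  calc 256 * (4 * (M / (4 * D)) * 32 ^ K) = (4 * (M / (4 * D))) * (256 * 32 ^ K) := by ring
    _ ≤ (4 * (M / (4 * D))) * D := Nat.mul_le_mul_left _ hD
    _ ≤ M := by linarith

/-- **The outer rung of the adjacent scheme is valid** (`K ≥ 1`, `D ≥ 256 · 32^K`, `M ≥ 64 D`, `n ≤ M`). [folklore] -/
theorem arung_validA {M n D K : ℕ} (hK : 1 ≤ K) (hD : 256 * 32 ^ K ≤ D) (hM : 64 * D ≤ M) (hn : n ≤ M) :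
    (arung M n D K).ValidA := by
  obtain ⟨hk, -, -, hμ⟩ := arung_sizes (K := K) hD hM
  exact
    { hk₀ := hk
      hK := hK
      hn := hn
      hμM := by show 64 * trapScale (4 * (M / (4 * D))) K ≤ M; omega
      hR₀ := by show 8 * trapScale (4 * (M / (4 * D))) K ≤ 8 * trapScale (4 * (M / (4 * D))) K; exact le_rfl
      hR₀M := by show 4 * (8 * trapScale (4 * (M / (4 * D))) K) ≤ M; omega
      hfour := ⟨M / (4 * D), rfl⟩ }

/-- Chunks per side of the ring of level `ℓ ≤ 7`: `nA ℓ ≤ 13 D + 4`. [folklore] -/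
theorem arung_nA_le {M n D K : ℕ} (hD : 256 * 32 ^ K ≤ D) (hM : 64 * D ≤ M) {ℓ : ℕ} (hℓ : ℓ ≤ 7) :
    (arung M n D K).nA ℓ ≤ 13 * D + 4 := by
  have hX : 1 ≤ 32 ^ K := Nat.one_le_pow _ _ (by norm_num)
  have hD1 : 1 ≤ D := by omega
  set q := M / (4 * D) with hq
  have hq16 : 16 ≤ q := (Nat.le_div_iff_mul_le (by omega)).2 (by linarith)
  have hqD : 4 * D * q ≤ M := Nat.mul_div_le M (4 * D)
  have hlt : M < 4 * D * q + 4 * D := by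
    have h := Nat.lt_div_mul_add (a := M) (b := 4 * D) (by omega)
    rw [← hq, Nat.mul_comm] at h; exact h
  have hq0 : 0 < q := by omega
  have h4q0 : 0 < 4 * q := by omega
  show (4 * q * ((2 * M + (2 * ℓ + 1) * (4 * q * 32 ^ K)) / (4 * q)) + 4 * q) / (4 * q / 4) ≤ 13 * D + 4
  rw [show 4 * q / 4 = q from by omega]
  set Q := (2 * M + (2 * ℓ + 1) * (4 * q * 32 ^ K)) / (4 * q) with hQ
  rw [show 4 * q * Q + 4 * q = q * (4 * (Q + 1)) by ring, Nat.mul_div_cancel_left _ hq0]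
  have e2 : Q = 2 * M / (4 * q) + (2 * ℓ + 1) * 32 ^ K := by
    rw [hQ, show (2 * ℓ + 1) * (4 * q * 32 ^ K) = 4 * q * ((2 * ℓ + 1) * 32 ^ K) by ring, Nat.add_mul_div_left _ _ h4q0]
  have e3 : 2 * M / (4 * q) ≤ 3 * D := by
    apply Nat.div_le_of_le_mul
    nlinarith
  rw [e2]
  have : (2 * ℓ + 1) * 32 ^ K ≤ 15 * 32 ^ K := Nat.mul_le_mul_right _ (by omega)
  have h60 : 4 * (15 * 32 ^ K) + 4 ≤ D + 4 := by omega
  nlinarith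

/-- **The level-`7` ring of the outer rung is short**: `GrA 7 ≤ 156 D + 44`. [folklore] -/
theorem arung_GrA7_le {M n D K : ℕ} (hD : 256 * 32 ^ K ≤ D) (hM : 64 * D ≤ M) :
    (arung M n D K).GrA 7 ≤ 156 * D + 44 := by
  have h := arung_nA_le (n := n) (K := K) hD hM (le_refl 7)
  show 12 * (arung M n D K).nA 7 - 4 ≤ 156 * D + 44
  omega

/-- The number of windows: `NwA ≤ 13 D + 5`. [folklore] -/
theorem arung_NwA_le {M n D K : ℕ} (hD : 256 * 32 ^ K ≤ D) (hM : 64 * D ≤ M) :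
    (arung M n D K).NwA ≤ 13 * D + 5 := by
  have h := arung_nA_le (n := n) (K := K) hD hM (show 0 ≤ 7 by norm_num)
  show (arung M n D K).nA 0 + 1 ≤ 13 * D + 5
  omega

/-- **The spokes of the outer rung fit RSW at aspect ratio `256 · 32^K`**: `LL 7 ≤ 256 · 32^K · (2ε)`. [folklore] -/
theorem arung_aspect7 {M n D K : ℕ} (hD : 256 * 32 ^ K ≤ D) (hM : 64 * D ≤ M) :
    (arung M n D K).LL 7 ≤ 256 * 32 ^ K * (2 * (arung M n D K).ε) := by
  obtain ⟨hk, -, -, -⟩ := arung_sizes (K := K) hD hM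
  have hX : 1 ≤ 32 ^ K := Nat.one_le_pow _ _ (by norm_num)
  set k₀ := 4 * (M / (4 * D)) with hk₀
  set X := 32 ^ K with hXd
  show (2 * 7 + 1) * (k₀ * X) + 2 * k₀ + 4 * (k₀ / 4) ≤ 256 * X * (2 * (k₀ / 16))
  have h4 : 4 * (k₀ / 4) ≤ k₀ := Nat.mul_div_le k₀ 4
  have h16 : k₀ ≤ 16 * (k₀ / 16) + 15 := by omega
  set f := k₀ / 16 with hf
  have hXf : X * k₀ ≤ 16 * (X * f) + 15 * X := by nlinarith
  have hkey : 480 * X + 3 * k₀ ≤ 16 * (X * k₀) := by nlinarith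
  nlinarith

/-- Every slot bound is at most `156 D + 45`. [folklore] -/
theorem arung_aslotBound_le {M n D K : ℕ} (hD : 256 * 32 ^ K ≤ D) (hM : 64 * D ≤ M) (q : Fin 8) (e : Fin 4) :
    aslotBound (arung M n D K) q e ≤ 156 * D + 45 := by
  have hX : K < 32 ^ K := Nat.lt_pow_self (by norm_num)
  have hNw := arung_NwA_le (n := n) (K := K) hD hM
  have hG7 := arung_GrA7_le (n := n) (K := K) hD hM
  have hK : (arung M n D K).K = K := rfl
  fin_cases q
  · show 6 ≤ 156 * D + 45; omega
  · show (arung M n D K).K ≤ 156 * D + 45; omega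
  · show (arung M n D K).NwA ≤ 156 * D + 45; omega
  · show 8 ≤ 156 * D + 45; omega
  · show (arung M n D K).GrA 7 + 1 ≤ 156 * D + 45; omega
  · show (arung M n D K).GrA 7 + 1 ≤ 156 * D + 45; omega
  · show (if (e : ℕ) = 0 then 6 else 5) ≤ 156 * D + 45; split_ifs <;> omega
  · show 5 ≤ 156 * D + 45; omega

/-- **The slot count of the outer rung is bounded in terms of `D` only.** [folklore] -/
theorem arung_slots_le {M n D K : ℕ} (hD : 256 * 32 ^ K ≤ D) (hM : 64 * D ≤ M) :
    (∏ q : Fin 8, ∏ e : Fin 4, aslotBound (arung M n D K) q e : ℕ) ≤ ((156 * D + 45) ^ 4) ^ 8 := by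
  have hb := arung_aslotBound_le (n := n) (K := K) hD hM
  calc (∏ q : Fin 8, ∏ e : Fin 4, aslotBound (arung M n D K) q e : ℕ)
      ≤ ∏ _q : Fin 8, (156 * D + 45) ^ 4 := by
        refine Finset.prod_le_prod' fun q _ => ?_
        calc ∏ e : Fin 4, aslotBound (arung M n D K) q e ≤ ∏ _e : Fin 4, (156 * D + 45) := Finset.prod_le_prod' fun e _ => hb q e
          _ = (156 * D + 45) ^ 4 := by rw [Finset.prod_const, Finset.card_univ, Fintype.card_fin]
    _ = ((156 * D + 45) ^ 4) ^ 8 := by rw [Finset.prod_const, Finset.card_univ, Fintype.card_fin]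

end Literature.Probability.Percolation
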